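import Literature.NumberTheory.LFunctions.WeilGroundStateRealZerosProofs
import HarnessLib

/-!
# Route WeilGroundState — crux `GroundStateSimpleEven` (stmt-RiemannHypothesis-1526), lever closure

Support file for line `Sketch` of the crux `∀ a > 0, WeilWindowSimpleEven a`: the BOOKKEEPING step
`stub_meanZeroGap_of_lever_of_localised`. Notation: `ε(a) = weilGroundEnergy a` (the bottom of
`Re Q` over `L²`-normalised test functions on the window `[-a, a]`), `Q = weilQuadratic`.

Hypotheses (both abstract, supplied by the other steps of the line):
* the LEVER `hlever`: `γ₁² · Re Q(h) ≤ Re Q(h')` for window test functions `h`, with `Λ < γ₁²`;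
* the LOCALISATION `hloc`: a window test function `h` whose derivative is a near-null state,
  `Re Q(h') ≤ (ε(a) + θ) ∫|h'|²`, has `∫|h'|² ≤ Λ ∫|h|²`.

Conclusion: a gap `δ = min θ (ε(a) (γ₁²/Λ − 1)) > 0` for MEAN-ZERO normalised window test
functions. Proof: a mean-zero window test function is a derivative `g = v'` of a window test
function (`ConnesVanSuijlekom.exists_primitive` with `w = 0`); either `Re Q(g) ≥ ε(a) + θ`, or the
localisation applies to `v` and `Re Q(g) ≥ γ₁² Re Q(v) ≥ γ₁² ε(a) ∫|v|² ≥ γ₁² ε(a) / Λ`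
(`ConnesVanSuijlekom.weilGroundEnergy_mul_le_re`).
-/

noncomputable section

open Set MeasureTheory

namespace Summit.RiemannHypothesis.RiemannHypothesis.Theorems

open Literature.NumberTheory.LFunctions

set_option linter.dupNamespace false in
/-- **Lever closure (bookkeeping).** If `ε(a) > 0`, window test functions satisfy the lever
`γ₁² Re Q(h) ≤ Re Q(h')` with `0 < Λ < γ₁²`, and near-null derivatives are localised
(`Re Q(h') ≤ (ε(a) + θ) ∫|h'|² → ∫|h'|² ≤ Λ ∫|h|²`), then mean-zero `L²`-normalised test functions on
`[-a, a]` have `Re Q(g) ≥ ε(a) + δ` with `δ = min θ (ε(a) (γ₁²/Λ − 1)) > 0`: write `g = v'`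
(`ConnesVanSuijlekom.exists_primitive`, `w = 0`); if `Re Q(g) < ε(a) + θ` then
`1 = ∫|v'|² ≤ Λ ∫|v|²`, so `Re Q(g) ≥ γ₁² Re Q(v) ≥ γ₁² ε(a) ∫|v|² ≥ γ₁² ε(a) / Λ`. [folklore] -/
theorem stub_meanZeroGap_of_lever_of_localised {a γ₁ Λ θ : ℝ} (hε : 0 < weilGroundEnergy a)
    (hΛ : 0 < Λ) (hΛγ : Λ < γ₁ ^ 2) (hθ : 0 < θ)
    (hlever : ∀ h : ℝ → ℂ, IsWeilTest h → tsupport h ⊆ Icc (-a) a →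
      γ₁ ^ 2 * (weilQuadratic h).re ≤ (weilQuadratic (deriv h)).re)
    (hloc : ∀ h : ℝ → ℂ, IsWeilTest h → tsupport h ⊆ Icc (-a) a →
      (weilQuadratic (deriv h)).re ≤ (weilGroundEnergy a + θ) * ∫ t, ‖deriv h t‖ ^ 2 →
        ∫ t, ‖deriv h t‖ ^ 2 ≤ Λ * ∫ t, ‖h t‖ ^ 2) :
    ∃ δ : ℝ, 0 < δ ∧ ∀ g : ℝ → ℂ, IsWeilTest g → tsupport g ⊆ Icc (-a) a →
      ∫ t, ‖g t‖ ^ 2 = (1 : ℝ) → ∫ t, g t = 0 → weilGroundEnergy a + δ ≤ (weilQuadratic g).re := by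
  set ε : ℝ := weilGroundEnergy a with hεdef
  have hquot : 1 < γ₁ ^ 2 / Λ := (one_lt_div hΛ).2 hΛγ
  have hδ₂ : 0 < ε * (γ₁ ^ 2 / Λ - 1) := mul_pos hε (sub_pos.2 hquot)
  refine ⟨min θ (ε * (γ₁ ^ 2 / Λ - 1)), lt_min hθ hδ₂, fun g hg hgs hnorm hmean ↦ ?_⟩
  -- a mean-zero window test function is a derivative of a window test function
  obtain ⟨v, hv, hvs, hvg', -⟩ :=
    ConnesVanSuijlekom.exists_primitive hg hgs 0 (by simpa using hmean)
  have hvg : deriv v = g := funext fun t ↦ by simpa using hvg' t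
  rcases le_or_gt (ε + θ) (weilQuadratic g).re with h1 | h2
  · calc ε + min θ (ε * (γ₁ ^ 2 / Λ - 1)) ≤ ε + θ := by gcongr; exact min_le_left _ _
      _ ≤ (weilQuadratic g).re := h1
  · -- `g = v'` is a near-null state: localise `v`
    have hloc' : ∫ t, ‖deriv v t‖ ^ 2 ≤ Λ * ∫ t, ‖v t‖ ^ 2 := by
      refine hloc v hv hvs ?_
      rw [hvg, hnorm, mul_one]
      exact h2.le
    rw [hvg, hnorm] at hloc'
    have hlev : γ₁ ^ 2 * (weilQuadratic v).re ≤ (weilQuadratic g).re := by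
      have := hlever v hv hvs
      rwa [hvg] at this
    have hgsv : ε * ∫ t, ‖v t‖ ^ 2 ≤ (weilQuadratic v).re :=
      ConnesVanSuijlekom.weilGroundEnergy_mul_le_re hv hvs
    have hγ : 0 ≤ γ₁ ^ 2 := sq_nonneg _
    have hA : ε * (γ₁ ^ 2 / Λ) ≤ ε * γ₁ ^ 2 * ∫ t, ‖v t‖ ^ 2 := by
      rw [← mul_div_assoc, div_le_iff₀ hΛ]
      calc ε * γ₁ ^ 2 = ε * γ₁ ^ 2 * 1 := (mul_one _).symm
        _ ≤ ε * γ₁ ^ 2 * (Λ * ∫ t, ‖v t‖ ^ 2) :=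
          mul_le_mul_of_nonneg_left hloc' (mul_nonneg hε.le hγ)
        _ = ε * γ₁ ^ 2 * (∫ t, ‖v t‖ ^ 2) * Λ := by ring
    have hB : ε * γ₁ ^ 2 * (∫ t, ‖v t‖ ^ 2) ≤ γ₁ ^ 2 * (weilQuadratic v).re := by
      calc ε * γ₁ ^ 2 * (∫ t, ‖v t‖ ^ 2) = γ₁ ^ 2 * (ε * ∫ t, ‖v t‖ ^ 2) := by ring
        _ ≤ γ₁ ^ 2 * (weilQuadratic v).re := mul_le_mul_of_nonneg_left hgsv hγ
    calc ε + min θ (ε * (γ₁ ^ 2 / Λ - 1)) ≤ ε + ε * (γ₁ ^ 2 / Λ - 1) := by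
          gcongr; exact min_le_right _ _
      _ = ε * (γ₁ ^ 2 / Λ) := by ring
      _ ≤ (weilQuadratic g).re := hA.trans (hB.trans hlev)

end Summit.RiemannHypothesis.RiemannHypothesis.Theorems

end
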